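import Literature.Probability.Percolation.MarkedLoopBoundarySpan
import Literature.Probability.Percolation.MarkedLoopTemperleyLiebDual
import Mathlib.LinearAlgebra.Dual.Lemmas
import HarnessLib

/-!
# The boundary link-pattern law as a vector of the planar Temperley–Lieb module; boundary span ⟺ the laws span the module («BOUNDARY-LAW-MODULE»)

Topic `Literature/Probability/Percolation`; generic-`k` layer of the marked-loop (Khristoforov–Smirnov) lineage; a rider on `MarkedLoopBoundarySpan.lean`
(«BSPAN-IFF-BNONVANISH»: `ArcPoint D a`, the predicates `BSpan k a` / `BNonvanish k a`, ★★★ `bSpan_iff_bNonvanish`, arc independence `bNonvanish_iff`) and on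
`MarkedLoopTemperleyLiebDual.lean` («TRIPOD-TL-DUAL»: ★ `solWDualEquiv n : solW (n+1) ≃ₗ[ℂ] Module.Dual ℂ (LinkPattern (n+2) →₀ ℂ)` — the tripod-law solution space
IS the dual of Pearce–Rittenberg–de Gier–Nienhuis's planar Temperley–Lieb module of the `(k+1)`-gon, `k = n+1`).

At a boundary mid-edge `z` on the HOME arc `A_{k−1}` of a `k`-marked domain the link pattern of a configuration of the XOR space `W(u_1,…,u_k,z)` is an
OUTERMOST pattern (`outAt (k−1) = Pat₀ k`, `cutCompat_iff_pdepth_eq_zero`), i.e. a link pattern of the `k+1` points `u_1, …, u_k, z` (`pat₀EquivLinkPattern`);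
counting configurations pattern by pattern gives

* `lawLP z : LinkPattern (k+1) →₀ ℂ` — **THE BOUNDARY LINK-PATTERN LAW OF `z` AS A VECTOR OF THE PLANAR MODULE** (coefficient of the link pattern `Q` = the
  number `N_q(z)` of configurations realising the outermost pattern `q` behind `Q`); `lawLP_apply`;
* ★★ `obsW_classWt_eq_solWDualEquiv_lawLP` — **THE PAIRING IDENTITY**: for every tripod-law solution `w`, the class-weighted `k`-disorder observable at `z` is
  the dual vector of `w` evaluated on the law of `z`: `ObsW D (classWt w) z = ⟪solWDualEquiv w, lawLP z⟫`;
* ★★★ `bNonvanish_last_iff_span_lawLP` — **BOUNDARY NON-DEGENERACY ⟺ THE BOUNDARY LAWS OF ALL `k`-MARKED DOMAINS SPAN THE PLANAR TEMPERLEY–LIEB MODULE**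
  `LinkPattern (k+1) →₀ ℂ` (the solution space being its full dual); with «BSPAN-IFF-BNONVANISH» and arc independence: ★★ `bSpan_iff_span_lawLP` /
  `bNonvanish_iff_span_lawLP` — `BSpan k a` at ANY arc ⟺ the home-arc laws span the module (`k ≥ 2`).

So the lane's boundary question behind door (U) (HOME `FINDING-TRIPOD-DOOR-U-TWO-CORNER.md` §2–§4) reads, in the Temperley–Lieb coordinates of the lineage: do the
percolation link-pattern laws of `(k+1)`-point boundary configurations, over all discrete domains, span Pearce–Rittenberg–de Gier–Nienhuis's link module? Nothing
about its truth is claimed here.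

## References
* M. Khristoforov, S. Smirnov, *Percolation and O(1) loop model*, arXiv:2111.15612 (2021), §1.2 (arXiv v1 p. 2: the law of the link pattern), §2 Definition 3 and
  Lemma 4 (p. 4), eq. (4) and Remark 6 (p. 5: boundary values).
* P. A. Pearce, V. Rittenberg, J. de Gier, B. Nienhuis, *Temperley–Lieb stochastic processes*, J. Phys. A 35 (2002) L661–L668, §2 (the link-pattern module).
* B. Bollobás, O. Riordan, *Percolation*, CUP (2006), Ch. 7 §7.2.2 (pp. 191–195: marked discrete domains and their arcs).

## Mathlib / tree
Mathlib: `Finsupp.equivFunOnFinite`, `Finsupp.linearCombination_apply`, `Finsupp.sum_fintype`, `Submodule.exists_dual_map_eq_bot_of_lt_top`, `Submodule.span_induction`,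
`Finset.sum_subtype`, `Fintype.sum_equiv`. Tree: `MarkedLoopBoundarySpan` (`ArcPoint`, `BNonvanish`, `BSpan`, `bSpan_iff_bNonvanish`, `bNonvanish_iff`),
`MarkedLoopTemperleyLiebDual` (`solWDualEquiv`, `solWDualEquiv_apply`), `MarkedLoopTemperleyLiebCoords` (`pat₀EquivLinkPattern`, `solWLinkEquiv_apply`), `MarkedLoopTripodCuts`
(`outAt`, `mem_outAt`, `cutCompat_iff_pdepth_eq_zero`, `obsW_classWt_eq_sum_outAt`), `MarkedLoopTripodBasis` (`Pat₀`, `solW`, `classWt`, `patternCount`).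
-/

open Finset

namespace Literature.Probability.Percolation.MarkedLoops

open Literature.Probability.Percolation Literature.Probability.LatticeModels
open Literature.Probability.Percolation.FivePoint (tau)
open Literature.Probability.LatticeModels.TemperleyLieb
open TriMarkedDomain

section LawModule

variable {n : ℕ} {D : TriMarkedDomain (n + 1)}

/-- **THE BOUNDARY LINK-PATTERN LAW of a boundary mid-edge `z` on the home arc, as a vector of the planar Temperley–Lieb module** `LinkPattern (k+1) →₀ ℂ`
(`k = n+1`): the coefficient of `Q` is the number of configurations at `z` realising the outermost pattern behind `Q`.
[cite: KhristoforovSmirnov2021, §1.2 (arXiv v1 p. 2: the law of the link pattern); PearceRittenbergDeGierNienhuis2002, §2 (the link-pattern module)] -/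
noncomputable def lawLP (z : ArcPoint D (Fin.last n)) : LinkPattern (n + 1 + 1) →₀ ℂ :=
  Finsupp.equivFunOnFinite.symm fun Q => (patternCount D z.v z.i ((pat₀EquivLinkPattern (n + 1)).symm Q).1 : ℂ)

/-- the law evaluated at a link pattern. [cite: KhristoforovSmirnov2021, §1.2 (arXiv v1 p. 2)] -/
theorem lawLP_apply (z : ArcPoint D (Fin.last n)) (Q : LinkPattern (n + 1 + 1)) :
    lawLP z Q = (patternCount D z.v z.i ((pat₀EquivLinkPattern (n + 1)).symm Q).1 : ℂ) := rfl

/-- the law evaluated at the link pattern of an outermost pattern `q`: `N_q(z)`. [cite: KhristoforovSmirnov2021, §1.2 (arXiv v1 p. 2)] -/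
theorem lawLP_apply_pat₀ (z : ArcPoint D (Fin.last n)) (q : Pat₀ (n + 1)) :
    lawLP z (pat₀EquivLinkPattern (n + 1) q) = (patternCount D z.v z.i q.1 : ℂ) := by
  rw [lawLP_apply, Equiv.symm_apply_apply]

/-- on the home arc the compatible patterns are the outermost ones. [cite: KhristoforovSmirnov2021, §1.2 (arXiv v1 p. 2); §2 eq. (4) (p. 5)] -/
theorem mem_outAt_last_iff (p : Pat (n + 1)) : p ∈ outAt (Fin.last n) ↔ p.pdepth = 0 := by
  rw [mem_outAt, cutCompat_iff_pdepth_eq_zero (a := Fin.last n) (by rw [Fin.val_last])]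

/-- ★★ **THE PAIRING IDENTITY**: for every tripod-law solution `w` and every boundary mid-edge `z` on the home arc,
`ObsW D (classWt w) z = ⟪solWDualEquiv w, lawLP z⟫` — the class-weighted observable is the dual vector of `w` evaluated on the boundary law.
[cite: KhristoforovSmirnov2021, §2 Definition 3 and Lemma 4 (arXiv v1 p. 4); eq. (4) and Remark 6 (p. 5); PearceRittenbergDeGierNienhuis2002, §2] -/
theorem obsW_classWt_eq_solWDualEquiv_lawLP (w : solW (n + 1)) (z : ArcPoint D (Fin.last n)) :
    ObsW D (classWt w.1) z.v z.i = solWDualEquiv n w (lawLP z) := by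
  rw [obsW_classWt_eq_sum_outAt w.1 z.allSides z.not_corner z.opp_not_corner z.side_eq z.mem_stretch, solWDualEquiv_apply,
    Finsupp.linearCombination_apply, Finsupp.sum_fintype _ _ (fun Q => by rw [zero_smul])]
  -- left: sum over the compatible patterns = the outermost ones; right: sum over link patterns
  rw [Finset.sum_subtype (outAt (Fin.last n)) (p := fun p : Pat (n + 1) => p.pdepth = 0) (fun p => mem_outAt_last_iff p),
    ← (pat₀EquivLinkPattern (n + 1)).sum_comp]
  refine Finset.sum_congr rfl fun q _ => ?_
  rw [lawLP_apply_pat₀, solWLinkEquiv_apply, Equiv.symm_apply_apply, smul_eq_mul, mul_comm]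

/-- ★★★ **BOUNDARY NON-DEGENERACY ON THE HOME ARC ⟺ THE BOUNDARY LINK-PATTERN LAWS OF ALL `k`-MARKED DOMAINS SPAN THE PLANAR TEMPERLEY–LIEB MODULE** (the
tripod-law solution space being the FULL dual of the module, a vector annihilated by every solution is annihilated by every functional).
[cite: KhristoforovSmirnov2021, §2 Lemma 4 (arXiv v1 p. 4); eq. (4) and Remark 6 (p. 5); PearceRittenbergDeGierNienhuis2002, §2 (the link-pattern module)] -/
theorem bNonvanish_last_iff_span_lawLP :
    BNonvanish (n + 1) (Fin.last n) ↔
      Submodule.span ℂ (Set.range fun zz : (Σ D : TriMarkedDomain (n + 1), ArcPoint D (Fin.last n)) => lawLP zz.2) = ⊤ := by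
  constructor
  · intro h
    by_contra hne
    obtain ⟨φ, hφ0, hφ⟩ := Submodule.exists_dual_map_eq_bot_of_lt_top (lt_top_iff_ne_top.2 hne) inferInstance
    apply hφ0
    -- the solution behind `φ` has vanishing boundary observable, hence is zero
    set w : solW (n + 1) := (solWDualEquiv n).symm φ with hw
    have hφw : φ = solWDualEquiv n w := by rw [hw, LinearEquiv.apply_symm_apply]
    have hzero : (w : Pat (n + 1) → ℂ) = 0 := by
      refine h w.1 w.2 fun D z => ?_
      rw [obsW_classWt_eq_solWDualEquiv_lawLP w z, ← hφw]
      have hmem : φ (lawLP z) ∈ (Submodule.span ℂ (Set.range fun zz : (Σ D : TriMarkedDomain (n + 1), ArcPoint D (Fin.last n)) => lawLP zz.2)).map φ :=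
        Submodule.mem_map_of_mem (Submodule.subset_span ⟨⟨D, z⟩, rfl⟩)
      rw [hφ] at hmem
      exact (Submodule.mem_bot ℂ).1 hmem
    have hw0 : w = 0 := Subtype.ext hzero
    rw [hφw, hw0, map_zero]
  · intro hspan w hw hobs
    -- the dual vector of `w` kills every law, hence the span, hence everything
    set φ := solWDualEquiv n ⟨w, hw⟩ with hφ
    have hφx : ∀ x, φ x = 0 := by
      intro x
      have hx : x ∈ Submodule.span ℂ (Set.range fun zz : (Σ D : TriMarkedDomain (n + 1), ArcPoint D (Fin.last n)) => lawLP zz.2) := by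
        rw [hspan]; exact Submodule.mem_top
      refine Submodule.span_induction ?_ ?_ ?_ ?_ hx
      · rintro _ ⟨⟨D, z⟩, rfl⟩
        rw [hφ, ← obsW_classWt_eq_solWDualEquiv_lawLP ⟨w, hw⟩ z]
        exact hobs D z
      · exact map_zero φ
      · intro x y _ _ hx hy; rw [map_add, hx, hy, add_zero]
      · intro c x _ hx; rw [map_smul, hx, smul_zero]
    have hφ0 : φ = 0 := LinearMap.ext fun x => by rw [hφx x, LinearMap.zero_apply]
    have hw0 : (⟨w, hw⟩ : solW (n + 1)) = 0 := (solWDualEquiv n).injective (by rw [← hφ, hφ0, map_zero])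
    exact congrArg Subtype.val hw0

/-- ★★ **BOUNDARY NON-DEGENERACY AT ANY ARC ⟺ THE HOME-ARC LAWS SPAN THE MODULE** (`k ≥ 2`; arc independence).
[cite: KhristoforovSmirnov2021, §1.2 (arXiv v1 p. 2: cyclic indexing); §2 Lemma 4 (p. 4); PearceRittenbergDeGierNienhuis2002, §2] -/
theorem bNonvanish_iff_span_lawLP {m : ℕ} (a : Fin (m + 2)) :
    BNonvanish (m + 2) a ↔
      Submodule.span ℂ (Set.range fun zz : (Σ D : TriMarkedDomain (m + 1 + 1), ArcPoint D (Fin.last (m + 1))) => lawLP zz.2) = ⊤ := by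
  rw [bNonvanish_iff a (Fin.last (m + 1))]
  exact bNonvanish_last_iff_span_lawLP

/-- ★★ **BOUNDARY SPAN AT ANY ARC ⟺ THE HOME-ARC LAWS SPAN THE MODULE** (`k ≥ 2`).
[cite: KhristoforovSmirnov2021, §2 eq. (4) and Remark 6 (arXiv v1 p. 5); PearceRittenbergDeGierNienhuis2002, §2 (the link-pattern module)] -/
theorem bSpan_iff_span_lawLP {m : ℕ} (a : Fin (m + 2)) :
    BSpan (m + 2) a ↔
      Submodule.span ℂ (Set.range fun zz : (Σ D : TriMarkedDomain (m + 1 + 1), ArcPoint D (Fin.last (m + 1))) => lawLP zz.2) = ⊤ := by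
  rw [bSpan_iff_bNonvanish]
  exact bNonvanish_iff_span_lawLP a

end LawModule

end Literature.Probability.Percolation.MarkedLoops
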